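import Literature.AlgebraicGeometry.Hyperkaehler.TotalCohomologyCross
import Literature.AlgebraicTopology.SingularHomology.CupProductExteriorH1
import Mathlib.LinearAlgebra.ExteriorPower.Basis
import Mathlib.LinearAlgebra.Finsupp.VectorSpace
import Mathlib.Data.Finset.Sort
import Mathlib.Data.Finset.Max
import HarnessLib

/-!
# The exterior frame of `H*(Y; R)`: the monomials `e_I = e_{i₁} ⌣ ⋯ ⌣ e_{i_k}` in degree-one classes

Layer `Literature/AlgebraicGeometry/Hyperkaehler`; companion of `LLVGeneration` (carriers `totalCohomology R Y = ⨁ₖ Hᵏ(Y; R)`,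
`ofDegree`, `totalCup`) and `TotalCohomologyCross` (`totalCup_assoc`, `totalCup_comm_ofDegree`).  For a family
`e : ι → H¹(Y; R)` indexed by a linearly ordered type and a finite set `I = {i₁ < ⋯ < i_k} ⊆ ι`, the **frame monomial**
`frame e I = e_{i₁} ⌣ e_{i₂} ⌣ ⋯ ⌣ e_{i_k} ∈ H*(Y; R)` (Hatcher, *Algebraic Topology*, Example 3.16: "`H*(Tⁿ; R)` is the
exterior algebra `Λ_R[α₁, ⋯, αₙ]` […] with basis the products `α_{i₁} ⋯ α_{i_k}`, `i₁ < ⋯ < i_k`").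

## Main results (all proved; no named fact)

* `totalCup_frame` — the **multiplication table** of the frame: for `2` invertible in `R`,
  `e_I ⌣ e_J = (-1)^{inv(I,J)} e_{I ∪ J}` if `I ∩ J = ∅` and `0` otherwise, where
  `invCount I J = #{(i, j) ∈ I × J | j < i}` is the number of inversions of the shuffle sorting `I` then `J`
  (graded commutativity `x ⌣ y = -y ⌣ x`, `x ⌣ x = 0` on `H¹`, Hatcher Thm. 3.11 — the tree's proved
  `cupProduct_gradedComm_holds`).  The sign is the one of `Literature/Computation/AbelianHilbFock/Fock.lean` (`wedgeSign`).
* `frame_eq_ofDegree` — `e_I ∈ H^{|I|}` is the iterated cup product `cupPowOne` of `CupProductExteriorH1` along the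
  increasing enumeration of `I`; `degreeOperator_frame` — `h e_I = (|I| - N) e_I`.
* `frameBasis` — if `H•(Y; R) = ⋀• H¹(Y; R)` (`HasExteriorCohomologyH1 R Y`, e.g. a complex torus / abelian variety:
  `Motives.abelianVarietyCohomologyExteriorH1_holds`) and `b` is a basis of `H¹(Y; R)` indexed by `ι`, the frame
  monomials `(e_I)_{I ⊆ ι}` form a basis of `H*(Y; R)` indexed by `Finset ι` (Mathlib's `Basis.exteriorPower`
  transported along `⋀ᵈ H¹ ≅ Hᵈ` and assembled over the degrees); `finite_of_frameBasis`,
  `finrank_eq_of_frameBasis` (`dim H*(Y; R) = 2^{|ι|}`).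

Written for cell `hodge-kum4` (lane (V), line v2 of `LefschetzGenerationHilb5`, PART (IV): the `16`-element frame of
`H*(A(ℂ); ℂ) = Λ*ℂ⁴` of an abelian surface in which the cup products and the dual Lefschetz operator become the
`16 × 16` integer matrices of the certificate (S2)).  Nothing here is specific to abelian varieties.

References: A. Hatcher, *Algebraic Topology* (2002) §3.2, Thm. 3.11, Example 3.16; H. Lange, Ch. Birkenhake,
*Complex Abelian Varieties* (1992), Lemma 1.1.17, Cor. 1.1.19 (`Hⁿ(X, ℂ) ≅ ∧ⁿ H¹(X, ℂ)`).
-/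

noncomputable section

open DirectSum
open Literature.AlgebraicTopology.SingularHomology

universe u v w

namespace Literature.AlgebraicGeometry.Hyperkaehler

variable {R : Type v} [CommRing R] {Y : Type u} [TopologicalSpace Y] {ι : Type w} [LinearOrder ι]

/-! ### Frame monomials -/

/-- The ordered cup product `e_{l₁} ⌣ (e_{l₂} ⌣ (⋯ ⌣ (e_{l_k} ⌣ 1)))` of degree-one classes along a LIST of indices
(auxiliary; `frame` is the case of the increasing enumeration of a finite set). [cite: HatcherAT2002, §3.2 Example 3.16] -/
def frameProd (e : ι → singularCohomology R R Y 1) : List ι → totalCohomology R Y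
  | [] => ofDegree R Y 0 (singularCohomology.one R Y)
  | i :: l => totalCup R Y (ofDegree R Y 1 (e i)) (frameProd e l)

/-- **The frame monomial `e_I = e_{i₁} ⌣ ⋯ ⌣ e_{i_k}`** (`I = {i₁ < ⋯ < i_k}`) of a family `e : ι → H¹(Y; R)` of
degree-one classes, an element of `H*(Y; R)` (Hatcher: "the products `α_{i₁} ⋯ α_{i_k}`, `i₁ < ⋯ < i_k`").
[cite: HatcherAT2002, §3.2 Example 3.16] -/
def frame (e : ι → singularCohomology R R Y 1) (I : Finset ι) : totalCohomology R Y :=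
  frameProd e (I.sort (· ≤ ·))

/-- **The inversion count** of the pair `(I, J)`: the number of pairs `(i, j) ∈ I × J` with `j < i`, written as
`Σ_{i ∈ I} #{j ∈ J | j < i}` — the parity of the shuffle that sorts the concatenation "`I` then `J`"; `(-1)^{invCount I J}`
is the sign `e_I ⌣ e_J = ± e_{I ∪ J}` (the computational tree's `Fock.wedgeSign`). [cite: HatcherAT2002, §3.2 Example 3.16] -/
def invCount (I J : Finset ι) : ℕ :=
  ∑ i ∈ I, (J.filter (· < i)).card

omit [TopologicalSpace Y] in
/-- `inv(∅, J) = 0`. [cite: HatcherAT2002, §3.2 Example 3.16] -/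
@[simp]
theorem invCount_empty (J : Finset ι) : invCount (∅ : Finset ι) J = 0 := by
  simp [invCount]

omit [TopologicalSpace Y] in
/-- `inv({a} ∪ s, J) = inv(s, J) + #{j ∈ J | j < a}` for `a ∉ s`. [cite: HatcherAT2002, §3.2 Example 3.16] -/
theorem invCount_insert [DecidableEq ι] {a : ι} {s : Finset ι} (ha : a ∉ s) (J : Finset ι) :
    invCount (insert a s) J = invCount s J + (J.filter (· < a)).card := by
  rw [invCount, Finset.sum_insert ha, add_comm]
  rfl

variable (e : ι → singularCohomology R R Y 1)

omit [LinearOrder ι] in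
/-- `frameProd e [] = 1`. [cite: HatcherAT2002, §3.2 Example 3.16] -/
@[simp]
theorem frameProd_nil : frameProd e [] = ofDegree R Y 0 (singularCohomology.one R Y) := rfl

omit [LinearOrder ι] in
/-- `frameProd e (i :: l) = e_i ⌣ frameProd e l`. [cite: HatcherAT2002, §3.2 Example 3.16] -/
@[simp]
theorem frameProd_cons (i : ι) (l : List ι) :
    frameProd e (i :: l) = totalCup R Y (ofDegree R Y 1 (e i)) (frameProd e l) := rfl

omit [LinearOrder ι] in
/-- Concatenation of index lists is the cup product (associativity of `⌣`). [cite: HatcherAT2002, §3.2 p. 211] -/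
theorem frameProd_append (l₁ l₂ : List ι) :
    frameProd e (l₁ ++ l₂) = totalCup R Y (frameProd e l₁) (frameProd e l₂) := by
  induction l₁ with
  | nil => rw [List.nil_append, frameProd_nil, one_totalCup]
  | cons i l ih => rw [List.cons_append, frameProd_cons, frameProd_cons, ih, totalCup_assoc]

omit [LinearOrder ι] in
/-- Re-indexing an iterated product of degree-one classes along equal lengths (plumbing). [cite: HatcherAT2002, §3.2 Example 3.16] -/
theorem ofDegree_cupPowOne_congr {d d' : ℕ} (hd : d = d') (v : Fin d → singularCohomology R R Y 1)
    (v' : Fin d' → singularCohomology R R Y 1) (hv : ∀ k, v k = v' (Fin.cast hd k)) :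
    ofDegree R Y d (cupPowOne R Y d v) = ofDegree R Y d' (cupPowOne R Y d' v') := by
  subst hd
  have : v = v' := funext fun k ↦ by rw [hv]; rfl
  rw [this]

omit [LinearOrder ι] in
/-- `frameProd e l` is the iterated cup product `m_k(e_{l₁}, …, e_{l_k}) ∈ Hᵏ(Y; R)` of `CupProductExteriorH1`.
[cite: HatcherAT2002, §3.2 Example 3.16] -/
theorem frameProd_eq_ofDegree (l : List ι) :
    frameProd e l = ofDegree R Y l.length (cupPowOne R Y l.length fun k ↦ e l[k]) := by
  induction l with
  | nil => rfl
  | cons a l ih =>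
    change frameProd e (a :: l) =
      ofDegree R Y (l.length + 1) (cupPowOne R Y (l.length + 1) fun k ↦ e (a :: l)[k])
    rw [frameProd_cons, ih, totalCup_lof, cupPowOne_succ]
    have htail : Fin.tail (fun k : Fin (l.length + 1) ↦ e (a :: l)[k]) = fun k ↦ e l[k] := by
      funext k
      simp [Fin.tail]
    rw [htail]
    exact ofDegree_cupProduct_index _ _ _ _

/-- **`e_I = e_{i₁} ⌣ ⋯ ⌣ e_{i_k} ∈ H^{|I|}(Y; R)`** is the iterated cup product of `CupProductExteriorH1` along the increasing
enumeration `I.orderEmbOfFin` of `I`. [cite: HatcherAT2002, §3.2 Example 3.16] -/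
theorem frame_eq_ofDegree (I : Finset ι) {d : ℕ} (h : I.card = d) :
    frame e I = ofDegree R Y d (cupPowOne R Y d (e ∘ I.orderEmbOfFin h)) := by
  rw [frame, frameProd_eq_ofDegree]
  exact ofDegree_cupPowOne_congr ((Finset.length_sort (· ≤ ·)).trans h) _ _ fun k ↦ rfl

/-- `e_I` is homogeneous of degree `|I|`. [cite: HatcherAT2002, §3.2 Example 3.16] -/
theorem exists_frame_eq_ofDegree (I : Finset ι) : ∃ x : singularCohomology R R Y I.card, frame e I = ofDegree R Y I.card x :=
  ⟨_, frame_eq_ofDegree e I rfl⟩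

/-- The degree operator on the frame: `h e_I = (|I| - N) e_I`. [cite: LooijengaLunts1997, §1 p. 3] -/
theorem degreeOperator_frame (N : ℕ) (I : Finset ι) :
    degreeOperator R Y N (frame e I) = ((I.card : R) - N) • frame e I := by
  obtain ⟨x, hx⟩ := exists_frame_eq_ofDegree e I
  rw [hx, degreeOperator_lof]

/-- `e_∅ = 1`. [cite: HatcherAT2002, §3.2 Example 3.16] -/
@[simp]
theorem frame_empty : frame e ∅ = ofDegree R Y 0 (singularCohomology.one R Y) := by
  rw [frame, Finset.sort_empty, frameProd_nil]

/-- `e_{{i}} = e_i`. [cite: HatcherAT2002, §3.2 Example 3.16] -/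
@[simp]
theorem frame_singleton (i : ι) : frame e {i} = ofDegree R Y 1 (e i) := by
  rw [frame, Finset.sort_singleton, frameProd_cons, frameProd_nil, totalCup_one]

/-- Adjoining a new minimum: `e_{{a} ∪ I} = e_a ⌣ e_I` if `a < I`. [cite: HatcherAT2002, §3.2 Example 3.16] -/
theorem frame_insert_of_forall_lt [DecidableEq ι] {a : ι} {I : Finset ι} (h : ∀ j ∈ I, a < j) :
    frame e (insert a I) = totalCup R Y (ofDegree R Y 1 (e a)) (frame e I) := by
  have ha : a ∉ I := fun ha ↦ lt_irrefl a (h a ha)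
  rw [frame, Finset.sort_insert (r := (· ≤ ·)) (fun b hb ↦ le_of_lt (h b hb)) ha, frameProd_cons]
  rfl

/-- Separated union: `e_{I ∪ J} = e_I ⌣ e_J` if every element of `I` is below every element of `J` (the sorted
enumeration of `I ∪ J` is the concatenation). [cite: HatcherAT2002, §3.2 Example 3.16] -/
theorem frame_union_of_forall_lt [DecidableEq ι] {I J : Finset ι} (h : ∀ i ∈ I, ∀ j ∈ J, i < j) :
    frame e (I ∪ J) = totalCup R Y (frame e I) (frame e J) := by
  have hd : Disjoint I J := Finset.disjoint_left.2 fun i hi hj ↦ lt_irrefl i (h i hi i hj)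
  have hperm : List.Perm ((I ∪ J).sort (· ≤ ·)) (I.sort (· ≤ ·) ++ J.sort (· ≤ ·)) := by
    rw [← Multiset.coe_eq_coe, ← Multiset.coe_add, Finset.sort_eq, Finset.sort_eq, Finset.sort_eq,
      ← Finset.disjUnion_eq_union I J hd]
    rfl
  have hsorted : List.Pairwise (· ≤ ·) (I.sort (· ≤ ·) ++ J.sort (· ≤ ·)) := by
    rw [List.pairwise_append]
    refine ⟨Finset.pairwise_sort I _, Finset.pairwise_sort J _, fun a ha b hb ↦ ?_⟩
    exact le_of_lt (h a ((Finset.mem_sort _).1 ha) b ((Finset.mem_sort _).1 hb))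
  have heq : (I ∪ J).sort (· ≤ ·) = I.sort (· ≤ ·) ++ J.sort (· ≤ ·) :=
    List.Perm.eq_of_pairwise' (Finset.pairwise_sort _ _) hsorted hperm
  rw [frame, heq, frameProd_append]
  rfl

omit [LinearOrder ι] in
/-- `x ⌣ (x ⌣ z) = 0` for `x ∈ H¹(Y; R)` (`x ⌣ x = 0`, `⅟2 ∈ R`). [cite: HatcherAT2002, §3.2 Thm. 3.11] -/
theorem totalCup_one_one_self [Invertible (2 : R)] (x : singularCohomology R R Y 1) (z : totalCohomology R Y) :
    totalCup R Y (ofDegree R Y 1 x) (totalCup R Y (ofDegree R Y 1 x) z) = 0 := by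
  rw [← totalCup_assoc, totalCup_lof, cup_self_deg_one, map_zero, map_zero, LinearMap.zero_apply]

/-- A degree-one class skew-commutes past a frame monomial: `x ⌣ (e_K ⌣ w) = (-1)^{|K|} e_K ⌣ (x ⌣ w)`.
[cite: HatcherAT2002, §3.2 Thm. 3.11] -/
theorem totalCup_one_frame (x : singularCohomology R R Y 1) (K : Finset ι) (w : totalCohomology R Y) :
    totalCup R Y (ofDegree R Y 1 x) (totalCup R Y (frame e K) w) =
      ((-1 : R) ^ K.card) • totalCup R Y (frame e K) (totalCup R Y (ofDegree R Y 1 x) w) := by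
  obtain ⟨y, hy⟩ := exists_frame_eq_ofDegree e K
  rw [← totalCup_assoc, hy, totalCup_comm_ofDegree 1 K.card x y, one_mul, LinearMap.map_smul₂, totalCup_assoc]

/-- A repeated index kills the product: `e_i ⌣ e_K = 0` for `i ∈ K`. [cite: HatcherAT2002, §3.2 Example 3.16] -/
theorem totalCup_one_frame_of_mem [Invertible (2 : R)] [DecidableEq ι] {i : ι} {K : Finset ι} (hi : i ∈ K) :
    totalCup R Y (ofDegree R Y 1 (e i)) (frame e K) = 0 := by
  set K₁ := K.filter (· < i) with hK₁
  set K₂ := (K.filter fun k ↦ i < k) with hK₂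
  have hK : K = K₁ ∪ insert i K₂ := by
    ext k
    simp only [hK₁, hK₂, Finset.mem_union, Finset.mem_filter, Finset.mem_insert]
    constructor
    · intro hk
      rcases lt_trichotomy k i with h | h | h
      · exact Or.inl ⟨hk, h⟩
      · exact Or.inr (Or.inl h)
      · exact Or.inr (Or.inr ⟨hk, h⟩)
    · rintro (⟨hk, _⟩ | rfl | ⟨hk, _⟩)
      · exact hk
      · exact hi
      · exact hk
  have h12 : ∀ a ∈ K₁, ∀ b ∈ insert i K₂, a < b := by
    intro a ha b hb
    simp only [hK₁, hK₂, Finset.mem_filter, Finset.mem_insert] at ha hb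
    rcases hb with rfl | ⟨_, hb⟩
    · exact ha.2
    · exact ha.2.trans hb
  have h2 : ∀ b ∈ K₂, i < b := fun b hb ↦ by
    simp only [hK₂, Finset.mem_filter] at hb
    exact hb.2
  rw [hK, frame_union_of_forall_lt e h12, frame_insert_of_forall_lt e h2, totalCup_one_frame,
    totalCup_one_one_self, map_zero, smul_zero]

/-- Inserting a fresh index: `e_i ⌣ e_K = (-1)^{#{k ∈ K | k < i}} e_{K ∪ {i}}` for `i ∉ K` (move `e_i` past the smaller
factors). [cite: HatcherAT2002, §3.2 Example 3.16] -/
theorem totalCup_one_frame_of_not_mem [DecidableEq ι] {i : ι} {K : Finset ι} (hi : i ∉ K) :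
    totalCup R Y (ofDegree R Y 1 (e i)) (frame e K) = ((-1 : R) ^ (K.filter (· < i)).card) • frame e (insert i K) := by
  set K₁ := K.filter (· < i) with hK₁
  set K₂ := (K.filter fun k ↦ i < k) with hK₂
  have hmem : ∀ k, k ∈ K → (k < i ∨ i < k) := fun k hk ↦
    (lt_trichotomy k i).elim Or.inl fun h ↦ h.elim (fun h ↦ absurd hk (h ▸ hi)) Or.inr
  have hK : K = K₁ ∪ K₂ := by
    ext k
    simp only [hK₁, hK₂, Finset.mem_union, Finset.mem_filter]
    constructor
    · intro hk
      exact (hmem k hk).elim (fun h ↦ Or.inl ⟨hk, h⟩) fun h ↦ Or.inr ⟨hk, h⟩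
    · rintro (⟨hk, _⟩ | ⟨hk, _⟩) <;> exact hk
  have hK' : insert i K = K₁ ∪ insert i K₂ := by
    rw [hK, Finset.union_insert]
  have h12 : ∀ a ∈ K₁, ∀ b ∈ K₂, a < b := by
    intro a ha b hb
    simp only [hK₁, hK₂, Finset.mem_filter] at ha hb
    exact ha.2.trans hb.2
  have h12' : ∀ a ∈ K₁, ∀ b ∈ insert i K₂, a < b := by
    intro a ha b hb
    rcases Finset.mem_insert.1 hb with rfl | hb
    · simp only [hK₁, Finset.mem_filter] at ha
      exact ha.2
    · exact h12 a ha b hb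
  have h2 : ∀ b ∈ K₂, i < b := fun b hb ↦ by
    simp only [hK₂, Finset.mem_filter] at hb
    exact hb.2
  rw [hK', frame_union_of_forall_lt e h12', frame_insert_of_forall_lt e h2]
  conv_lhs => rw [hK, frame_union_of_forall_lt e h12, totalCup_one_frame]

/-- **The multiplication table of the frame**: `e_I ⌣ e_J = (-1)^{inv(I,J)} e_{I ∪ J}` if `I ∩ J = ∅`, and `e_I ⌣ e_J = 0`
otherwise (`⅟2 ∈ R`; any family `e` of degree-one classes, not necessarily independent).  This is the exterior-algebra
rule `α_I α_J = ε α_{I ∪ J}` of Hatcher's Example 3.16, with the sign made explicit as the inversion count of the shuffle.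
[cite: HatcherAT2002, §3.2 Thm. 3.11 and Example 3.16] -/
theorem totalCup_frame [Invertible (2 : R)] [DecidableEq ι] (I J : Finset ι) :
    totalCup R Y (frame e I) (frame e J) =
      if Disjoint I J then ((-1 : R) ^ invCount I J) • frame e (I ∪ J) else 0 := by
  induction I using Finset.induction_on_min with
  | empty => simp [one_totalCup]
  | insert a s has ih =>
    have ha : a ∉ s := fun h ↦ lt_irrefl a (has a h)
    rw [frame_insert_of_forall_lt e has, totalCup_assoc, ih]
    by_cases hsJ : Disjoint s J
    · rw [if_pos hsJ, map_smul]
      by_cases haJ : a ∈ J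
      · have hne : ¬Disjoint (insert a s) J := by
          rw [Finset.disjoint_insert_left]
          exact fun h ↦ h.1 haJ
        rw [if_neg hne, totalCup_one_frame_of_mem e (Finset.mem_union_right s haJ), smul_zero]
      · have hd : Disjoint (insert a s) J := Finset.disjoint_insert_left.2 ⟨haJ, hsJ⟩
        have hasJ : a ∉ s ∪ J := by
          rw [Finset.mem_union, not_or]
          exact ⟨ha, haJ⟩
        have hfilter : (s ∪ J).filter (· < a) = J.filter (· < a) := by
          ext k
          simp only [Finset.mem_filter, Finset.mem_union]
          constructor
          · rintro ⟨hk | hk, hlt⟩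
            · exact absurd hlt (not_lt.2 (le_of_lt (has k hk)))
            · exact ⟨hk, hlt⟩
          · rintro ⟨hk, hlt⟩
            exact ⟨Or.inr hk, hlt⟩
        rw [if_pos hd, totalCup_one_frame_of_not_mem e hasJ, hfilter, smul_smul, ← pow_add,
          invCount_insert ha, Finset.insert_union]
    · have hne : ¬Disjoint (insert a s) J := by
        rw [Finset.disjoint_insert_left]
        exact fun h ↦ hsJ h.2
      rw [if_neg hsJ, if_neg hne, map_zero]

/-- Disjoint case of the multiplication table. [cite: HatcherAT2002, §3.2 Example 3.16] -/
theorem totalCup_frame_of_disjoint [Invertible (2 : R)] [DecidableEq ι] {I J : Finset ι} (h : Disjoint I J) :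
    totalCup R Y (frame e I) (frame e J) = ((-1 : R) ^ invCount I J) • frame e (I ∪ J) := by
  rw [totalCup_frame, if_pos h]

/-- Overlapping case of the multiplication table. [cite: HatcherAT2002, §3.2 Example 3.16] -/
theorem totalCup_frame_of_not_disjoint [Invertible (2 : R)] [DecidableEq ι] {I J : Finset ι} (h : ¬Disjoint I J) :
    totalCup R Y (frame e I) (frame e J) = 0 := by
  rw [totalCup_frame, if_neg h]

/-! ### The frame basis of `H*(Y; R)` when `H•(Y; R) = ⋀• H¹(Y; R)` -/

section Basis

variable [Invertible (2 : R)]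

/-- In degree `d`, the frame monomials of a basis `b` of `H¹` indexed by the `d`-element subsets are the image of Mathlib's
basis `b.exteriorPower d` of `⋀ᵈ H¹` under the comparison isomorphism `⋀ᵈ H¹ ≅ Hᵈ`. [cite: LangeBirkenhake1992, Cor. 1.1.19] -/
theorem ofDegree_equiv_exteriorPower (h : HasExteriorCohomologyH1 R Y)
    (b : Module.Basis ι R (singularCohomology R R Y 1)) (d : ℕ) (s : Set.powersetCard ι d) :
    ofDegree R Y d (h.equiv d (b.exteriorPower d s)) = frame b s.val := by
  rw [exteriorPower.basis_apply, HasExteriorCohomologyH1.equiv_apply, exteriorPower.ιMulti_family,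
    wedgeToCup_ιMulti, frame_eq_ofDegree (b : ι → singularCohomology R R Y 1) s.val s.prop]
  rfl

/-- The frame monomials of a basis of `H¹(Y; R)` are linearly independent in `H*(Y; R)` (when `H• = ⋀• H¹`).
[cite: HatcherAT2002, §3.2 Example 3.16] -/
theorem linearIndependent_frame (h : HasExteriorCohomologyH1 R Y)
    (b : Module.Basis ι R (singularCohomology R R Y 1)) : LinearIndependent R fun I : Finset ι ↦ frame b I := by
  classical
  let f : ∀ d : ℕ, Set.powersetCard ι d → singularCohomology R R Y d := fun d s ↦ h.equiv d (b.exteriorPower d s)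
  have hf : ∀ d, LinearIndependent R (f d) := fun d ↦ ((b.exteriorPower d).map (h.equiv d)).linearIndependent
  have hli : LinearIndependent R fun ix : Σ d : ℕ, Set.powersetCard ι d ↦
      (lof R ℕ (fun k ↦ singularCohomology R R Y k) ix.1 (f ix.1 ix.2) : totalCohomology R Y) :=
    DFinsupp.linearIndependent_single f hf
  have key : (fun I : Finset ι ↦ frame b I) =
      (fun ix : Σ d : ℕ, Set.powersetCard ι d ↦
        (lof R ℕ (fun k ↦ singularCohomology R R Y k) ix.1 (f ix.1 ix.2) : totalCohomology R Y)) ∘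
        Set.powersetCard.prodEquiv.symm := by
    funext I
    rw [Function.comp_apply, Set.powersetCard.prodEquiv_symm_apply]
    exact (ofDegree_equiv_exteriorPower h b I.card (Set.powersetCard.ofCard rfl)).symm
  rw [key]
  exact hli.comp _ Set.powersetCard.prodEquiv.symm.injective

/-- The frame monomials of a basis of `H¹(Y; R)` span `H*(Y; R)` (when `H• = ⋀• H¹`). [cite: HatcherAT2002, §3.2 Example 3.16] -/
theorem span_frame_eq_top (h : HasExteriorCohomologyH1 R Y) (b : Module.Basis ι R (singularCohomology R R Y 1)) :
    Submodule.span R (Set.range fun I : Finset ι ↦ frame b I) = ⊤ := by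
  classical
  refine eq_top_iff.2 fun x hx ↦ ?_
  clear hx
  induction x using DirectSum.induction_on with
  | zero => exact Submodule.zero_mem _
  | add x y hx hy => exact Submodule.add_mem _ hx hy
  | of d y =>
    rw [← lof_eq_of R]
    have hy : y ∈ Submodule.span R (Set.range ((b.exteriorPower d).map (h.equiv d))) := by
      rw [Module.Basis.span_eq]
      exact Submodule.mem_top
    have himg := Submodule.apply_mem_span_image_of_mem_span (ofDegree R Y d) hy
    refine Submodule.span_mono ?_ himg
    rintro _ ⟨_, ⟨s, rfl⟩, rfl⟩
    refine ⟨s.val, ?_⟩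
    simp only [Module.Basis.map_apply]
    exact (ofDegree_equiv_exteriorPower h b d s).symm

/-- **The frame basis of `H*(Y; R)`**: for `H•(Y; R) = ⋀• H¹(Y; R)` and a basis `b` of `H¹(Y; R)` indexed by a linearly
ordered `ι`, the monomials `e_I = b_{i₁} ⌣ ⋯ ⌣ b_{i_k}` (`I ⊆ ι` finite) form a basis of `H*(Y; R)` indexed by `Finset ι`
(Hatcher Example 3.16: "with basis the products `α_{i₁} ⋯ α_{i_k}`, `i₁ < ⋯ < i_k`"). [cite: HatcherAT2002, §3.2 Example 3.16]
[cite: LangeBirkenhake1992, Cor. 1.1.19] -/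
def frameBasis (h : HasExteriorCohomologyH1 R Y) (b : Module.Basis ι R (singularCohomology R R Y 1)) :
    Module.Basis (Finset ι) R (totalCohomology R Y) :=
  Module.Basis.mk (linearIndependent_frame h b) (span_frame_eq_top h b).ge

/-- The frame basis vectors are the frame monomials. [cite: HatcherAT2002, §3.2 Example 3.16] -/
@[simp]
theorem frameBasis_apply (h : HasExteriorCohomologyH1 R Y) (b : Module.Basis ι R (singularCohomology R R Y 1))
    (I : Finset ι) : frameBasis h b I = frame b I :=
  Module.Basis.mk_apply _ _ I

/-- The frame basis as a function. [cite: HatcherAT2002, §3.2 Example 3.16] -/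
theorem coe_frameBasis (h : HasExteriorCohomologyH1 R Y) (b : Module.Basis ι R (singularCohomology R R Y 1)) :
    ⇑(frameBasis h b) = fun I ↦ frame b I :=
  funext (frameBasis_apply h b)

/-- `H*(Y; R)` is a finite module when `H¹` has a finite basis and `H• = ⋀• H¹`. [cite: HatcherAT2002, §3.2 Example 3.16] -/
theorem finite_of_frameBasis [Finite ι] (h : HasExteriorCohomologyH1 R Y)
    (b : Module.Basis ι R (singularCohomology R R Y 1)) : Module.Finite R (totalCohomology R Y) :=
  Module.Finite.of_basis (frameBasis h b)

/-- **`dim H*(Y; R) = 2^{dim H¹}`** when `H• = ⋀• H¹`. [cite: LangeBirkenhake1992, Cor. 1.1.19] -/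
theorem finrank_eq_of_frameBasis [Fintype ι] [StrongRankCondition R] (h : HasExteriorCohomologyH1 R Y)
    (b : Module.Basis ι R (singularCohomology R R Y 1)) :
    Module.finrank R (totalCohomology R Y) = 2 ^ Fintype.card ι := by
  rw [Module.finrank_eq_card_basis (frameBasis h b), Fintype.card_finset]

end Basis

end Literature.AlgebraicGeometry.Hyperkaehler

end
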